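import Summits.Parity.GeneralizedHardyLittlewood.Theorems.ChenParityOracleBLAPHostParityFromBrickVaughanTools
import Literature.NumberTheory.LFunctions.LiouvilleSumClassicalBound
import HarnessLib

/-!
# Route `ChenParityOracleBLAP` — crux S1 = `HostParityFromBrick` (stmt-Parity-20045): Vaughan's Type-II pieces — one dyadic block

Support file for the prime half `K1 → K2 → HP1` of S1 (step (V)).  A dyadic block of a Type-II
piece of Vaughan's identity against the weight `h_d(k) = 1_{(k,P)=1}[d ∣ k+2]λ(k+2)`,
`∑_{M<b≤2M} a(b) ∑_{V₀<t≤y/b} g(t) h_d(bt)` with `|a| ≤ L₁` on the block and `|g| ≤ L₂` on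
`[1, y]`, is `L₁L₂` times a hyperbolic bilinear form with K-class coefficients (normalised,
supported on integers coprime to `P = (N−1)#`, hence with all prime factors `≥ N ≥ w₀`); so the
hyperbolic Type-II bound `HTII` (hypothesis, the shape of `typeII_hyperbolic_static`) gives
`∑_{d} |block_d| ≤ L₁ L₂ X₂` (`typeII_block_le`).

References: H. Iwaniec, E. Kowalski, *Analytic Number Theory* (2004), §13.4 [IwaniecKowalski2004].
-/

namespace Summit.Parity.GeneralizedHardyLittlewood.Theorems

open Finset Real
open ArithmeticFunction (liouville)

/-- Integers coprime to `(N−1)#` have all prime factors `≥ w₀` once `w₀ ≤ N`. -/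
theorem primeFactors_ge_of_coprime_primorial {N k : ℕ} {w₀ : ℝ} (hw : w₀ ≤ N) (hk : k ≠ 0)
    (hcop : Nat.Coprime k (primorial (N - 1))) : ∀ p ∈ k.primeFactors, w₀ ≤ (p : ℝ) := by
  intro p hp
  have := (coprime_primorial_iff hk).1 hcop p hp
  exact hw.trans (by exact_mod_cast this)

/-- **One dyadic block of a Type-II piece.**  See the module docstring. -/
theorem typeII_block_le {y M V₀ P N : ℕ} (hP : P = primorial (N - 1)) {w₀ : ℝ} (hw : w₀ ≤ N)
    (Dset : Finset ℕ) {X₂ L₁ L₂ : ℝ} (hL₁ : 0 < L₁) (hL₂ : 0 < L₂)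
    (HTII : ∀ α β : ℕ → ℝ, (∀ n, |α n| ≤ 1) → (∀ n, |β n| ≤ 1) →
      (∀ n, α n ≠ 0 → ∀ p ∈ n.primeFactors, w₀ ≤ (p : ℝ)) →
      (∀ n, β n ≠ 0 → ∀ p ∈ n.primeFactors, w₀ ≤ (p : ℝ)) →
      ∑ d ∈ Dset, |∑ m ∈ Ioc M (2 * M), ∑ n ∈ Ioc V₀ (y / m),
        α m * β n * (if d ∣ m * n + 2 then (liouville (m * n + 2) : ℝ) else 0)| ≤ X₂)
    (a g : ℕ → ℝ) (ha : ∀ b ∈ Ioc M (2 * M), |a b| ≤ L₁) (hg : ∀ t ∈ Icc 1 y, |g t| ≤ L₂) :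
    ∑ d ∈ Dset, |∑ b ∈ Ioc M (2 * M), a b * ∑ t ∈ Ioc V₀ (y / b), g t *
        ((if Nat.Coprime (b * t) P then (1 : ℝ) else 0) *
          (if d ∣ b * t + 2 then (liouville (b * t + 2) : ℝ) else 0))| ≤ L₁ * L₂ * X₂ := by
  classical
  set α : ℕ → ℝ := fun b => if b ∈ Ioc M (2 * M) ∧ Nat.Coprime b P then a b / L₁ else 0 with hα
  set β : ℕ → ℝ := fun t => if t ∈ Icc 1 y ∧ Nat.Coprime t P then g t / L₂ else 0 with hβ
  have hα1 : ∀ n, |α n| ≤ 1 := by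
    intro n; simp only [hα]; split_ifs with h
    · rw [abs_div, abs_of_pos hL₁, div_le_one hL₁]; exact ha n h.1
    · simp
  have hβ1 : ∀ n, |β n| ≤ 1 := by
    intro n; simp only [hβ]; split_ifs with h
    · rw [abs_div, abs_of_pos hL₂, div_le_one hL₂]; exact hg n h.1
    · simp
  have hαs : ∀ n, α n ≠ 0 → ∀ p ∈ n.primeFactors, w₀ ≤ (p : ℝ) := by
    intro n hn
    simp only [hα] at hn
    split_ifs at hn with h
    · have hn0 : n ≠ 0 := by have := h.1; rw [Finset.mem_Ioc] at this; omega
      exact primeFactors_ge_of_coprime_primorial hw hn0 (hP ▸ h.2)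
    · exact absurd rfl hn
  have hβs : ∀ n, β n ≠ 0 → ∀ p ∈ n.primeFactors, w₀ ≤ (p : ℝ) := by
    intro n hn
    simp only [hβ] at hn
    split_ifs at hn with h
    · have hn0 : n ≠ 0 := by have := h.1; rw [Finset.mem_Icc] at this; omega
      exact primeFactors_ge_of_coprime_primorial hw hn0 (hP ▸ h.2)
    · exact absurd rfl hn
  have h := HTII α β hα1 hβ1 hαs hβs
  -- identify the block sum with `L₁ L₂ ·` the normalised bilinear form
  have hid : ∀ d : ℕ, ∑ b ∈ Ioc M (2 * M), a b * ∑ t ∈ Ioc V₀ (y / b), g t *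
        ((if Nat.Coprime (b * t) P then (1 : ℝ) else 0) *
          (if d ∣ b * t + 2 then (liouville (b * t + 2) : ℝ) else 0)) =
      L₁ * L₂ * ∑ m ∈ Ioc M (2 * M), ∑ n ∈ Ioc V₀ (y / m),
        α m * β n * (if d ∣ m * n + 2 then (liouville (m * n + 2) : ℝ) else 0) := by
    intro d
    rw [Finset.mul_sum]
    refine Finset.sum_congr rfl fun b hb => ?_
    rw [Finset.mul_sum, Finset.mul_sum]
    refine Finset.sum_congr rfl fun t ht => ?_
    have hty : t ∈ Icc 1 y := by
      rw [Finset.mem_Ioc] at ht hb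
      rw [Finset.mem_Icc]
      exact ⟨by omega, ht.2.trans (Nat.div_le_self y b)⟩
    simp only [hα, hβ, hb, hty, true_and]
    by_cases hbP : Nat.Coprime b P
    · by_cases htP : Nat.Coprime t P
      · rw [if_pos (Nat.Coprime.mul_left hbP htP), if_pos hbP, if_pos htP]
        field_simp
      · rw [if_neg (fun h => htP (Nat.Coprime.coprime_mul_left h)), if_neg htP]
        ring
    · rw [if_neg (fun h => hbP (Nat.Coprime.coprime_mul_right h)), if_neg hbP]
      ring
  have hL : 0 ≤ L₁ * L₂ := by positivity
  simp only [hid, abs_mul, abs_of_nonneg hL, ← Finset.mul_sum]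
  exact mul_le_mul_of_nonneg_left h hL

end Summit.Parity.GeneralizedHardyLittlewood.Theorems
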